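import Literature.Computability.AlgebraicComplexity.RectangularExponentAlpha
import Literature.Computability.AlgebraicComplexity.RectangularExponentCertReduction
import HarnessLib

/-!
# `α ≥ 0.321334` (VXXZ 2024): what a laser-method certificate would have to say, and what the published one supports

Topic `Literature/Computability/AlgebraicComplexity`; companion of `RectangularExponentAlpha.lean` (PROVED:
`vxxz2024_alpha_ge ↔ ω_ℂ(1, 0.321334, 1) ≤ 2`), `RectangularExponentLaserCertificate.lean` (the table-indexed
predicate `CW5DegenerationCertificate` and the PROVED passage `omegaRect_le_of_cw5DegenerationCertificate` from a
certificate to the bounds) and `RectangularExponentCertReduction.lean` (the printed / certificate-backed 2024 tables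
from such certificates).  Everything in this file is PROVED; no definition, no new named fact (D-0026).  It records, for the
compute-certificate ledger of the named fact `vxxz2024_alpha_ge` (`α ≥ 0.321334`, Vassilevska Williams–Xu–Xu–Zhou,
SODA 2024, abstract, §1.1 Table 1 row `ω(1, 0.321334, 1) = 2`, §8), exactly which certificate discharges it and the
result of auditing the authors' published certificate against that requirement.

## Proved here

* `le_dualExponentAlpha_of_cw5Certificate` — a `CW_5` degeneration certificate for the single row `(κ, 2)`, `κ ≥ 0`,
  gives `ω_ℂ(1, κ, 1) = 2` and hence `κ ≤ α` (flattening `ω(1,κ,1) ≥ 2` + `ω(1,p,1) = 2 ↔ p ≤ α`);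
  `le_dualExponentAlpha_of_cw5Certificate_of_le` — monotone in `κ`;
* `vxxz2024_alpha_ge_of_cw5Certificate` — the row `(0.321334, 2)` gives `vxxz2024_alpha_ge`;
  `vxxz2024_alpha_ge_of_cw5Certificate_table` — so does a certificate for the whole printed Table 1
  (`CW5DegenerationCertificate vxxz2024Table`, the trust base of `vxxz2024_omegaRect_table`);
* `omegaRect_le_of_cw5Certificate_alphaRow_tight` / `…_alphaRow_certified` — the rows `(0.321334, 2 + 1.5·10⁻⁹)` and
  `(0.321334, 2.000001)` give the corresponding NON-sharp bounds (the second is the `α`-row of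
  `vxxz2024TableCertified`, `RectangularExponentCert.lean`); by convexity/monotonicity no row `(κ, 2 + ε)` with `ε > 0`
  yields any exact-`2` statement, i.e. any lower bound on `α`.

So the honest trust base of `vxxz2024_alpha_ge` is `CW5DegenerationCertificate [(0.321334, 2)]` = layer (T), the
paper's §4–§7 (Thm 5.3 global stage, Thm 6.1, Thm 6.3 constituent stage, Cor 4.2 hole fixing: "§8-program feasible at
`(κ, ω')` ⇒ degeneration of `2^{o(n)} · CW_5^{⊗4n}` into copies of `⟨a, a^κ, a⟩` with `V^{1/n} a^{ω'/n} → 7^4`",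
unformalised), applied to layer (C), an EXACTLY feasible point of the §8 program (`q = 5`, `ℓ* = 3`) at `κ = 0.321334`,
`ω' = 2`.

## Audit of layer (C) for the `α` row (harness compute-cert session 2026-08-15, this unit; folder evidence
`ESTIMATE.md`, `REPORT.md`, `job/*.py`, `job/cert_*.json`)

Source artifact: §8, "The code and parameters are available at https://osf.io/7wgh2/" — `rmmcode.zip`, sha256
`63d24c223724d92c20419d7cea332c7d24dfa8fe59e1daa98b1d620de92d0a12`; the `α` row is `data/alpha_0.32133405.mat`
(1 × 6759 IEEE doubles), produced in the optimiser's `'alpha'` mode, which maximises `κ` with `ω'` BOXED to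
`[2, 2 + 10⁻⁹]` ("We restrict omega == 2. A negligible error of 1e-9 is allowed", `src/evaluation/Workspace.m`) and is
accepted by `src/verify/VerifyAlpha.m` at max-violation `≤ 1.1·10⁻⁹`.
(F) An independent line-by-line Python port of `src/{evaluation,autograd,utils,complete_split,verify}` (values; it
registers exactly the 6759 parameters / 2623 groups / 2273 linear equality rows / 25 + 1514 nonlinear rows of the
original) reproduces `Script.m` on all 24 files (objectives to 12 digits, e.g. `κ' = 0.321334051847219`,
`ω' = 2 + 10⁻⁹` for the `α` file; max residual `9.2·10⁻¹¹` on the 22 `K` files and the `μ` file, all 25 inequality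
rows tight there).  The `α` file is different in kind: its inequality rows are violated by up to `5.9·10⁻¹⁰`
(`single_mat_size` exceeds `mat_size₁`, `mat_size₂`) and several rows are slack by up to `7.8·10⁻⁴`.
(R) Rigorous functional.  With the auxiliary `min`-variables replaced by the exact minima they abbreviate and every
max-entropy penalty `P_α = max_{α' ∈ D} H(α') − H(α)` replaced by its weak-duality upper bound
`Σ_t e^{L_t − 1} − Σ_t α_t L_t − H(α)`, `L_t = u(i_t) + v(j_t) + w(k_t) + 1` (sound: a larger penalty only lowers the
bound it enters; it eliminates `α_max` and all Lagrange/marginal-sharing equalities), feasibility of the program at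
`(κ, ω')` is `G := ω' · min(ms₁, ms₂, ms₃/κ) + Σ_blocks min_t bound_{b,t} − 4 log 7 ≥ 0`, evaluated at an exact
rational point (simplices renormalised to sum exactly `1`) with all transcendental functions in 256-bit interval
arithmetic at exact rational arguments (interval widths `≤ 10⁻⁷⁵`).  At the published point, `κ = 0.321334`, `ω' = 2`:
`G ≥ −3.798·10⁻⁹` only (`= −10⁻⁹ · ms₁ − 1.2·10⁻⁹` of row violations) — NOT feasible.
(O) Local re-optimisation at fixed `(κ, ω') = (0.321334, 2)` over all 3099 primal parameters (prox-linear method with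
entropic prox, exact max-entropy terms by IPF with envelope gradients, dual subproblems solved to gap `≤ 10⁻¹²`;
validated on the `κ = 0.34` file moved to `κ = 0.335`, where it gains `6.3·10⁻⁴` in one step): `G` rises from
`−3.800·10⁻⁹` to `−3.725·10⁻⁹` and is then first-order stationary (model-certified ascent `< 2·10⁻¹¹` for prox radii up
to `η = 8·10³`); the SAME plateau `−3.74·10⁻⁹` is reached at `κ = 0.3213, 0.321, 0.320, 0.30` (the `ms₃/κ` slack is
worthless: the value `2·min(ms₁, ms₂) + Σ retains` is locally MAXIMAL at the published point, `3.74·10⁻⁹` short of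
`4 log 7`), and reviving the 175 parameters parked at `0` only costs.  Rigorous certificates (files `job/cert_*.json`,
exact rationals + multiplier tables, re-checkable by `job/rigorous.py`): `(0.321334, 2 + 1.5·10⁻⁹)` FEASIBLE,
`(0.321334, 2.000001)` FEASIBLE, `(0.321334, 2)` not (`G ≥ −3.73·10⁻⁹` at the optimised point).
Conclusion of the audit: the published parameters, and every point reached from them by exact local re-optimisation,
certify `ω_ℂ(1, 0.321334, 1) ≤ 2 + 1.44·10⁻⁹` and no exact-`2` row at any `κ` tried (`0.30 ≤ κ ≤ 0.321334`); the
printed `α ≥ 0.321334` rests on reading the optimiser's box top `ω' = 2 + 10⁻⁹` (plus a `1.2·10⁻⁹` feasibility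
tolerance; `sn_options_for_refine.spc`: major feasibility tolerance `0.9·10⁻¹⁰`, relative) as `ω' = 2`.  Whether some
other point of the (non-convex) program is exactly feasible at `(0.321334, 2)` is open; the authors' search produced none.  A certificate for `vxxz2024_alpha_ge`
in the sense of this file would need a fresh optimisation reaching `ω' ≤ 2` exactly (the previous record
`α > 0.31389`, Le Gall–Urrutia 2018, is of that exact kind); none is published.  This is evidence about the published
certificate, not a refutation of the (plausible) printed statement, which stays a named fact.

## References

* V. Vassilevska Williams, Y. Xu, Z. Xu, R. Zhou, *New bounds for matrix multiplication: from alpha to omega*, SODA 2024,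
  arXiv:2307.07970: abstract (`α ≥ 0.321334`); §1.1 Table 1; §4.1; Cor. 4.2; Thm. 5.3; Thm. 6.1; Thm. 6.3; §8
  (optimisation problem, "Numerical results", code and parameters at https://osf.io/7wgh2/: `rmmcode.zip`,
  `src/evaluation/Workspace.m`, `src/verify/VerifyAlpha.m`, `data/alpha_0.32133405.mat`).
  [VassilevskaWilliamsXuXuZhou2024]
* F. Le Gall, F. Urrutia, *Improved rectangular matrix multiplication using powers of the Coppersmith–Winograd
  tensor*, SODA 2018, §1 (`α > 0.31389`). [LeGallUrrutia2018]
-/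

noncomputable section

namespace Literature.Computability.AlgebraicComplexity

open Literature.Barriers.MatrixMultiplication

/-! ## Exact-`2` certificates are exactly the lower bounds on `α` -/

/-- **A `CW_5` degeneration certificate for the single row `(κ, 2)`, `κ ≥ 0`, proves `κ ≤ α`**: it gives
`ω_ℂ(1, κ, 1) ≤ 2` (`omegaRect_le_of_cw5DegenerationCertificate`: Schönhage's rectangular asymptotic sum inequality and
`R̃(CW_5) ≤ 7`, both theorems of the tree), flattening gives `≥ 2`, and `ω(1, p, 1) = 2 ↔ p ≤ α`.
[cite: VassilevskaWilliamsXuXuZhou2024, §4.1 and §8] -/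
theorem le_dualExponentAlpha_of_cw5Certificate {κ : ℝ} (hκ : 0 ≤ κ)
    (h : CW5DegenerationCertificate [(κ, 2)]) : κ ≤ dualExponentAlpha ℂ := by
  have hle : omegaRect ℂ 1 κ 1 ≤ 2 :=
    omegaRect_le_of_cw5DegenerationCertificate h (List.mem_singleton.2 rfl) hκ
  exact le_dualExponentAlpha_of_omegaRect_eq_two ℂ (le_antisymm hle (two_le_omegaRect_one_mid_one ℂ κ))

/-- Monotone form: a certificate at `(κ', 2)` proves `κ ≤ α` for every `κ ≤ κ'` (so a certificate is free to sit at
any `κ' ≥ κ`, e.g. the optimiser's un-rounded `κ' = 0.321334051847…` for the printed `κ = 0.321334`).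
[cite: VassilevskaWilliamsXuXuZhou2024, §8] -/
theorem le_dualExponentAlpha_of_cw5Certificate_of_le {κ κ' : ℝ} (hκ' : 0 ≤ κ') (hle : κ ≤ κ')
    (h : CW5DegenerationCertificate [(κ', 2)]) : κ ≤ dualExponentAlpha ℂ :=
  hle.trans (le_dualExponentAlpha_of_cw5Certificate hκ' h)

/-- Conversely to nothing: a certified row `(κ, 2)` pins the exponent, `ω_ℂ(1, κ, 1) = 2`.
[cite: VassilevskaWilliamsXuXuZhou2024, §1.1 Table 1] -/
theorem omegaRect_eq_two_of_cw5Certificate {κ : ℝ} (hκ : 0 ≤ κ)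
    (h : CW5DegenerationCertificate [(κ, 2)]) : omegaRect ℂ 1 κ 1 = 2 :=
  omegaRect_eq_two_of_le_dualExponentAlpha ℂ (le_dualExponentAlpha_of_cw5Certificate hκ h)

/-! ## The named fact `vxxz2024_alpha_ge` from its certificate -/

/-- **`α ≥ 0.321334` from a laser-method certificate for the printed `α`-row `(0.321334, 2)` of Table 1** — the exact
trust base of the named fact `vxxz2024_alpha_ge` (layers (T)+(C) of the module docstring; the published layer (C)
reaches only `ω' = 2 + 1.44·10⁻⁹`, see the audit there). [cite: VassilevskaWilliamsXuXuZhou2024, abstract and §8] -/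
theorem vxxz2024_alpha_ge_of_cw5Certificate (h : CW5DegenerationCertificate [((0.321334 : ℝ), 2)]) :
    vxxz2024_alpha_ge :=
  le_dualExponentAlpha_of_cw5Certificate (by norm_num) h

/-- … equivalently, in the `ω(1, κ, 1) ≤ 2` form of `RectangularExponentAlpha.lean`.
[cite: VassilevskaWilliamsXuXuZhou2024, §1.1 Table 1] -/
theorem omegaRect_alphaRow_le_two_of_cw5Certificate (h : CW5DegenerationCertificate [((0.321334 : ℝ), 2)]) :
    omegaRect ℂ 1 0.321334 1 ≤ 2 :=
  vxxz2024_alpha_ge_iff_omegaRect_le_two.1 (vxxz2024_alpha_ge_of_cw5Certificate h)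

/-- A certificate for the whole PRINTED Table 1 (the trust base of `vxxz2024_omegaRect_table`,
`RectangularExponentCertReduction.lean`) contains the `α`-row and therefore also proves `vxxz2024_alpha_ge`.
[cite: VassilevskaWilliamsXuXuZhou2024, §1.1 Table 1 and §8] -/
theorem vxxz2024_alpha_ge_of_cw5Certificate_table (h : CW5DegenerationCertificate vxxz2024Table) :
    vxxz2024_alpha_ge :=
  vxxz2024_alpha_ge_of_omegaRect_table (vxxz2024_omegaRect_table_of_cw5Certificate h)

/-! ## What the published parameters support at `κ = 0.321334` (non-sharp rows) -/

/-- The tightest clean row supported by the published `α` file after exact local re-optimisation,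
`(0.321334, 2 + 1.5·10⁻⁹)` (rigorous certificate `job/cert_K0321334_w2p15e-10.json` of the audit; the exact row
`(0.321334, 2)` fails there by `3.7·10⁻⁹` in the Schönhage row): it yields only `ω_ℂ(1, 0.321334, 1) ≤ 2 + 1.5·10⁻⁹`.
[cite: VassilevskaWilliamsXuXuZhou2024, §8 (osf.io/7wgh2, data/alpha_0.32133405.mat)] -/
theorem omegaRect_le_of_cw5Certificate_alphaRow_tight
    (h : CW5DegenerationCertificate [((0.321334 : ℝ), 2.0000000015)]) :
    omegaRect ℂ 1 0.321334 1 ≤ 2.0000000015 :=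
  omegaRect_le_of_cw5DegenerationCertificate h (List.mem_singleton.2 rfl) (by norm_num)

/-- The `α`-row `(0.321334, 2.000001)` of the certificate-backed table `vxxz2024TableCertified`
(`RectangularExponentCert.lean`; rigorous layer-(C) certificate `job/cert_K0321334_w2000001.json` of the audit):
`ω_ℂ(1, 0.321334, 1) ≤ 2.000001`, the statement `vxxz2024_omegaRect_table_certified.alpha_row`.
[cite: VassilevskaWilliamsXuXuZhou2024, §8 (osf.io/7wgh2) and §1.1 Table 1] -/
theorem omegaRect_le_of_cw5Certificate_alphaRow_certified
    (h : CW5DegenerationCertificate [((0.321334 : ℝ), 2.000001)]) :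
    omegaRect ℂ 1 0.321334 1 ≤ 2.000001 :=
  omegaRect_le_of_cw5DegenerationCertificate h (List.mem_singleton.2 rfl) (by norm_num)

/-- Why non-sharp rows never reach `α`: for `p > α` the exponent is `> 2`, so a bound `ω(1, κ, 1) ≤ 2 + ε` with
`ε > 0` is consistent with `κ > α`; contrapositively, `κ ≤ α` needs the exact row.  Stated as: if every `ε > 0` is
certified at `κ` then `κ ≤ α` (closedness of the level set, `RectangularExponentAlpha.lean`).
[cite: VassilevskaWilliamsXuXuZhou2024, §1] -/
theorem le_dualExponentAlpha_of_forall_cw5Certificate {κ : ℝ} (hκ : 0 ≤ κ)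
    (h : ∀ ε : ℝ, 0 < ε → CW5DegenerationCertificate [(κ, 2 + ε)]) : κ ≤ dualExponentAlpha ℂ := by
  refine le_dualExponentAlpha_of_omegaRect_eq_two ℂ (le_antisymm ?_ (two_le_omegaRect_one_mid_one ℂ κ))
  refine le_of_forall_pos_lt_add fun ε hε => ?_
  have := omegaRect_le_of_cw5DegenerationCertificate (h (ε / 2) (half_pos hε)) (List.mem_singleton.2 rfl) hκ
  linarith

end Literature.Computability.AlgebraicComplexity

end
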